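import Summits.KontsevichZagierPeriods.KontsevichZagierPeriods.Theorems.PlanarAreas.Negative.Core
import Literature.NumberTheory.Transcendental.KZCalculusProofs
import Literature.NumberTheory.Transcendental.KZIntervalPeriodProofs
import Literature.NumberTheory.Transcendental.SemialgebraicMapsProofs
import Mathlib.Analysis.Calculus.Deriv.Inv
import Mathlib.Analysis.Calculus.FDeriv.Mul
import Mathlib.Analysis.Calculus.FDeriv.Pow

/-!
# `PlanarAreas` (stmt-KontsevichZagierPeriods-4990), line `green-native-bands`: the exceptional set of
# `stub_mixedPartials` must contain the `C¹`-singular points — a refuted strengthening (Peano)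

Refuter unit `drefute-stmt-KontsevichZagierPeriods-4990` on the lead's skeleton
(`Cruxes/PlanarAreas/Lines/green-native-bands.lean`). `stub_mixedPartials` asserts, for
`ℚ`-semialgebraic `A, B` on the closed triangle `Δ` with a potential `S` (`dS = A da + B db` on the
open triangle), the EXISTENCE of a `ℚ`-semialgebraic null set `Z` off which `∂_b A` and `∂_a B` exist
and agree — true on paper (generic smoothness + Schwarz). The natural POINTWISE strengthening
`MixedPartialsPointwise` — "at every point of the open triangle where both fibre derivatives exist,
they agree", i.e. `Z :=` the two non-differentiability loci — is FALSE (`not_mixedPartialsPointwise`),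
even for `A, B` continuous on `Δ` (the typed Green generator's hypotheses): the shifted Peano potential
`S(a,b) = P(4a − 1, 4b − 1)/16`, `P(U,V) = UV(U² − V²)/(U² + V²)` (`P(0) = 0`), is `C¹` with continuous
`ℚ`-semialgebraic gradient `(A, B)`, and at the interior point `(¼,¼)` one has `A(¼, s) = −(s − ¼)` and
`B(s, ¼) = s − ¼`, so `∂_b A = −1 ≠ 1 = ∂_a B` with both fibre derivatives existing. Hence any `Z` in
`stub_mixedPartials` must contain the `C¹`-singular points of `(A, B)` (the lead's plan via
`IsSemialgebraicFunOn.exists_contDiffOn_holds` does), not only the non-differentiability loci.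
-/

noncomputable section

open Set MeasureTheory MvPolynomial Filter Topology
open Literature.NumberTheory.Transcendental Literature.ModelTheory.ExponentialFields

namespace Summit.KontsevichZagierPeriods.PlanarAreas.Negative.GreenBands

/-- The natural pointwise strengthening of `stub_mixedPartials` (with the continuity hypotheses of
the typed Green generator added, to make the refutation as strong as possible): wherever both fibre
derivatives exist in the open triangle, they agree. -/
def MixedPartialsPointwise : Prop := ∀ (A B S : (Fin 2 → ℝ) → ℝ),
    IsSemialgebraicFunOn ℚ {p : Fin 2 → ℝ | 0 ≤ p 0 ∧ 0 ≤ p 1 ∧ p 0 + p 1 ≤ 1} A →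
    IsSemialgebraicFunOn ℚ {p : Fin 2 → ℝ | 0 ≤ p 0 ∧ 0 ≤ p 1 ∧ p 0 + p 1 ≤ 1} B →
    ContinuousOn A {p : Fin 2 → ℝ | 0 ≤ p 0 ∧ 0 ≤ p 1 ∧ p 0 + p 1 ≤ 1} →
    ContinuousOn B {p : Fin 2 → ℝ | 0 ≤ p 0 ∧ 0 ≤ p 1 ∧ p 0 + p 1 ≤ 1} →
    (∀ p : Fin 2 → ℝ, 0 < p 0 → 0 < p 1 → p 0 + p 1 < 1 →
      HasFDerivAt S (A p • ContinuousLinearMap.proj (R := ℝ) (φ := fun _ : Fin 2 => ℝ) 0 +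
        B p • ContinuousLinearMap.proj (R := ℝ) (φ := fun _ : Fin 2 => ℝ) 1) p) →
    ∀ p : Fin 2 → ℝ, 0 < p 0 → 0 < p 1 → p 0 + p 1 < 1 →
      DifferentiableAt ℝ (fun s : ℝ => A ![p 0, s]) (p 1) →
      DifferentiableAt ℝ (fun s : ℝ => B ![s, p 1]) (p 0) →
      deriv (fun s : ℝ => A ![p 0, s]) (p 1) = deriv (fun s : ℝ => B ![s, p 1]) (p 0)

/-! ## The shifted Peano potential and its gradient (coordinates `U = 4a − 1`, `V = 4b − 1`) -/

/-- The potential `S = UV(U² − V²)/(16 (U² + V²))` (`= 0` at `U = V = 0` by `x/0 = 0`). -/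
def peanoS : (Fin 2 → ℝ) → ℝ := fun p =>
  (4 * p 0 - 1) * (4 * p 1 - 1) * ((4 * p 0 - 1) ^ 2 - (4 * p 1 - 1) ^ 2) /
    (16 * ((4 * p 0 - 1) ^ 2 + (4 * p 1 - 1) ^ 2))

/-- `A = ∂_a S = V(U⁴ + 4U²V² − V⁴)/(4 (U² + V²)²)`. -/
def peanoA : (Fin 2 → ℝ) → ℝ := fun p =>
  (4 * p 1 - 1) * ((4 * p 0 - 1) ^ 4 + 4 * (4 * p 0 - 1) ^ 2 * (4 * p 1 - 1) ^ 2 - (4 * p 1 - 1) ^ 4) /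
    (4 * ((4 * p 0 - 1) ^ 2 + (4 * p 1 - 1) ^ 2) ^ 2)

/-- `B = ∂_b S = U(U⁴ − 4U²V² − V⁴)/(4 (U² + V²)²)`. -/
def peanoB : (Fin 2 → ℝ) → ℝ := fun p =>
  (4 * p 0 - 1) * ((4 * p 0 - 1) ^ 4 - 4 * (4 * p 0 - 1) ^ 2 * (4 * p 1 - 1) ^ 2 - (4 * p 1 - 1) ^ 4) /
    (4 * ((4 * p 0 - 1) ^ 2 + (4 * p 1 - 1) ^ 2) ^ 2)

/-- The vertical fibre of `A` through the singular point is linear: `A(¼, s) = −(s − ¼)`. -/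
theorem peanoA_fibre (s : ℝ) : peanoA ![1/4, s] = -(s - 1/4) := by
  simp only [peanoA, Matrix.cons_val_zero, Matrix.cons_val_one]
  by_cases hs : 4 * s - 1 = 0
  · have : s = 1/4 := by linarith
    subst this
    norm_num
  · field_simp
    ring

/-- The horizontal fibre of `B` through the singular point is linear: `B(s, ¼) = s − ¼`. -/
theorem peanoB_fibre (s : ℝ) : peanoB ![s, 1/4] = s - 1/4 := by
  simp only [peanoB, Matrix.cons_val_zero, Matrix.cons_val_one]
  by_cases hs : 4 * s - 1 = 0
  · have : s = 1/4 := by linarith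
    subst this
    norm_num
  · field_simp
    ring

/-- `∂_b A (¼,¼) = −1`. -/
theorem hasDerivAt_peanoA_fibre :
    HasDerivAt (fun s : ℝ => peanoA ![(![1/4, 1/4] : Fin 2 → ℝ) 0, s]) (-1) ((![1/4, 1/4] : Fin 2 → ℝ) 1) := by
  have h : (fun s : ℝ => peanoA ![(![1/4, 1/4] : Fin 2 → ℝ) 0, s]) = fun s => (1/4 : ℝ) - s := by
    funext s
    simp only [Matrix.cons_val_zero]
    rw [peanoA_fibre s]
    ring
  rw [h]
  exact ((hasDerivAt_const ((![1/4, 1/4] : Fin 2 → ℝ) 1) (1/4 : ℝ)).sub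
    (hasDerivAt_id ((![1/4, 1/4] : Fin 2 → ℝ) 1))).congr_deriv (by norm_num)

/-- `∂_a B (¼,¼) = 1`. -/
theorem hasDerivAt_peanoB_fibre :
    HasDerivAt (fun s : ℝ => peanoB ![s, (![1/4, 1/4] : Fin 2 → ℝ) 1]) 1 ((![1/4, 1/4] : Fin 2 → ℝ) 0) := by
  have h : (fun s : ℝ => peanoB ![s, (![1/4, 1/4] : Fin 2 → ℝ) 1]) = fun s => s - 1/4 := by
    funext s
    simp only [Matrix.cons_val_one]
    exact peanoB_fibre s
  rw [h]
  simpa using (hasDerivAt_id ((![1/4, 1/4] : Fin 2 → ℝ) 0)).sub_const (1/4 : ℝ)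

/-! ## Semialgebraicity -/

/-- The (total) inverse of a polynomial is a `ℚ`-semialgebraic function on every
`ℚ`-semialgebraic set. -/
theorem isSemialgebraicFunOn_inv_aeval {m : ℕ} {s : Set (Fin m → ℝ)} (hs : IsSemialgebraic ℚ s)
    (q : MvPolynomial (Fin m) ℚ) : IsSemialgebraicFunOn ℚ s (fun x => (aeval x q)⁻¹) := by
  have h1 : IsSemialgebraicFunOn ℚ (s ∩ {x | aeval x q ≠ 0}) (fun x => (aeval x q)⁻¹) :=
    (isSemialgebraicFunOn_aeval_div_aeval (hs.inter (isSemialgebraic_setOf_eval_ne_zero q)) 1 q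
      (fun x hx => hx.2)).congr fun x _ => by simp [one_div]
  have h2 : IsSemialgebraicFunOn ℚ (s ∩ {x | aeval x q = 0}) (fun x => (aeval x q)⁻¹) :=
    (isSemialgebraicFunOn_natCast (hs.inter (isSemialgebraic_setOf_eval_eq_zero q)) 0).congr
      fun x hx => by
        have hx0 : aeval x q = 0 := hx.2
        simp [hx0]
  have hU : s ∩ {x | aeval x q ≠ 0} ∪ s ∩ {x | aeval x q = 0} = s := by
    rw [← inter_union_distrib_left]
    exact inter_eq_left.mpr fun x _ => ne_or_eq _ _
  rw [← hU]
  exact h1.union h2 (fun _ _ => rfl) (fun _ _ => rfl)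

/-- The polynomial `U = 4X₀ − 1`. -/
def polU : MvPolynomial (Fin 2) ℚ := 4 * X 0 - 1
/-- The polynomial `V = 4X₁ − 1`. -/
def polV : MvPolynomial (Fin 2) ℚ := 4 * X 1 - 1

/-- Evaluation of `polU`. -/
@[simp] theorem aeval_polU (x : Fin 2 → ℝ) : aeval x polU = 4 * x 0 - 1 := by
  simp [polU, map_sub, map_mul]

/-- Evaluation of `polV`. -/
@[simp] theorem aeval_polV (x : Fin 2 → ℝ) : aeval x polV = 4 * x 1 - 1 := by
  simp [polV, map_sub, map_mul]

/-- `A` is `ℚ`-semialgebraic on every `ℚ`-semialgebraic set (polynomial times inverse polynomial). -/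
theorem isSemialgebraicFunOn_peanoA {s : Set (Fin 2 → ℝ)} (hs : IsSemialgebraic ℚ s) :
    IsSemialgebraicFunOn ℚ s peanoA := by
  have hN := isSemialgebraicFunOn_aeval hs
    (polV * (polU ^ 4 + 4 * polU ^ 2 * polV ^ 2 - polV ^ 4) : MvPolynomial (Fin 2) ℚ)
  have hD := isSemialgebraicFunOn_inv_aeval hs (4 * (polU ^ 2 + polV ^ 2) ^ 2 : MvPolynomial (Fin 2) ℚ)
  refine (IsSemialgebraicFunOn.mul_holds hN hD).congr fun x _ => ?_
  simp only [Pi.mul_apply, map_mul, map_sub, map_add, map_pow, aeval_polU, aeval_polV, map_ofNat,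
    peanoA, div_eq_mul_inv]

/-- `B` is `ℚ`-semialgebraic on every `ℚ`-semialgebraic set. -/
theorem isSemialgebraicFunOn_peanoB {s : Set (Fin 2 → ℝ)} (hs : IsSemialgebraic ℚ s) :
    IsSemialgebraicFunOn ℚ s peanoB := by
  have hN := isSemialgebraicFunOn_aeval hs
    (polU * (polU ^ 4 - 4 * polU ^ 2 * polV ^ 2 - polV ^ 4) : MvPolynomial (Fin 2) ℚ)
  have hD := isSemialgebraicFunOn_inv_aeval hs (4 * (polU ^ 2 + polV ^ 2) ^ 2 : MvPolynomial (Fin 2) ℚ)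
  refine (IsSemialgebraicFunOn.mul_holds hN hD).congr fun x _ => ?_
  simp only [Pi.mul_apply, map_mul, map_sub, map_add, map_pow, aeval_polU, aeval_polV, map_ofNat,
    peanoB, div_eq_mul_inv]

/-! ## Continuity (the gradient is continuous on all of `ℝ²`) -/

/-- Numerator bound for `A`: `|U⁴ + 4U²V² − V⁴| ≤ 2 (U² + V²)²`. -/
theorem abs_numA_le (U V : ℝ) : |U ^ 4 + 4 * U ^ 2 * V ^ 2 - V ^ 4| ≤ 2 * (U ^ 2 + V ^ 2) ^ 2 := by
  rw [abs_le]
  constructor <;> nlinarith [sq_nonneg (U ^ 2), sq_nonneg (V ^ 2), mul_nonneg (sq_nonneg U) (sq_nonneg V)]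

/-- Numerator bound for `B`: `|U⁴ − 4U²V² − V⁴| ≤ 2 (U² + V²)²`. -/
theorem abs_numB_le (U V : ℝ) : |U ^ 4 - 4 * U ^ 2 * V ^ 2 - V ^ 4| ≤ 2 * (U ^ 2 + V ^ 2) ^ 2 := by
  rw [abs_le]
  constructor <;> nlinarith [sq_nonneg (U ^ 2), sq_nonneg (V ^ 2), mul_nonneg (sq_nonneg U) (sq_nonneg V)]

/-- `|A| ≤ |V|/2`. -/
theorem abs_peanoA_le (p : Fin 2 → ℝ) : |peanoA p| ≤ |4 * p 1 - 1| / 2 := by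
  set U : ℝ := 4 * p 0 - 1 with hU
  set V : ℝ := 4 * p 1 - 1 with hV
  have hA : peanoA p = V * (U ^ 4 + 4 * U ^ 2 * V ^ 2 - V ^ 4) / (4 * (U ^ 2 + V ^ 2) ^ 2) := rfl
  rw [hA]
  by_cases hW : U ^ 2 + V ^ 2 = 0
  · rw [hW]
    simp
    positivity
  · have hWpos : 0 < U ^ 2 + V ^ 2 := lt_of_le_of_ne (by positivity) (Ne.symm hW)
    rw [abs_div, abs_mul, abs_of_pos (by positivity : (0:ℝ) < 4 * (U ^ 2 + V ^ 2) ^ 2),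
      div_le_div_iff₀ (by positivity) (by norm_num : (0:ℝ) < 2)]
    have h1 := abs_numA_le U V
    have h2 := abs_nonneg V
    nlinarith

/-- `|B| ≤ |U|/2`. -/
theorem abs_peanoB_le (p : Fin 2 → ℝ) : |peanoB p| ≤ |4 * p 0 - 1| / 2 := by
  set U : ℝ := 4 * p 0 - 1 with hU
  set V : ℝ := 4 * p 1 - 1 with hV
  have hB : peanoB p = U * (U ^ 4 - 4 * U ^ 2 * V ^ 2 - V ^ 4) / (4 * (U ^ 2 + V ^ 2) ^ 2) := rfl
  rw [hB]
  by_cases hW : U ^ 2 + V ^ 2 = 0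
  · rw [hW]
    simp
    positivity
  · have hWpos : 0 < U ^ 2 + V ^ 2 := lt_of_le_of_ne (by positivity) (Ne.symm hW)
    rw [abs_div, abs_mul, abs_of_pos (by positivity : (0:ℝ) < 4 * (U ^ 2 + V ^ 2) ^ 2),
      div_le_div_iff₀ (by positivity) (by norm_num : (0:ℝ) < 2)]
    have h1 := abs_numB_le U V
    have h2 := abs_nonneg U
    nlinarith

/-- The common denominator `(U² + V²)` vanishes only at `(¼,¼)`. -/
theorem eq_quarter_of_den_eq_zero {p : Fin 2 → ℝ} (h : (4 * p 0 - 1) ^ 2 + (4 * p 1 - 1) ^ 2 = 0) :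
    p 0 = 1/4 ∧ p 1 = 1/4 := by
  have h0 : (4 * p 0 - 1) ^ 2 = 0 := by nlinarith [sq_nonneg (4 * p 0 - 1), sq_nonneg (4 * p 1 - 1)]
  have h1 : (4 * p 1 - 1) ^ 2 = 0 := by nlinarith [sq_nonneg (4 * p 0 - 1), sq_nonneg (4 * p 1 - 1)]
  have h0' := pow_eq_zero_iff (n := 2) (by norm_num) |>.mp h0
  have h1' := pow_eq_zero_iff (n := 2) (by norm_num) |>.mp h1
  constructor <;> linarith

/-- `A` is continuous everywhere. -/
theorem continuous_peanoA : Continuous peanoA := by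
  rw [continuous_iff_continuousAt]
  intro p
  by_cases hW : (4 * p 0 - 1) ^ 2 + (4 * p 1 - 1) ^ 2 = 0
  · -- the singular point: squeeze with `|A| ≤ |V|/2`
    obtain ⟨hp0, hp1⟩ := eq_quarter_of_den_eq_zero hW
    have hA0 : peanoA p = 0 := by
      simp only [peanoA, hW]
      simp
    have hg : Tendsto (fun q : Fin 2 → ℝ => |4 * q 1 - 1| / 2) (𝓝 p) (𝓝 0) := by
      have hc : Continuous (fun q : Fin 2 → ℝ => |4 * q 1 - 1| / 2) := by fun_prop
      have := hc.tendsto p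
      simpa [hp1] using this
    rw [ContinuousAt, hA0]
    exact squeeze_zero_norm (fun q => by simpa [Real.norm_eq_abs] using abs_peanoA_le q) hg
  · have hc : ContinuousAt (fun q : Fin 2 → ℝ =>
        (4 * q 1 - 1) * ((4 * q 0 - 1) ^ 4 + 4 * (4 * q 0 - 1) ^ 2 * (4 * q 1 - 1) ^ 2 - (4 * q 1 - 1) ^ 4) /
          (4 * ((4 * q 0 - 1) ^ 2 + (4 * q 1 - 1) ^ 2) ^ 2)) p := by
      refine ContinuousAt.div (by fun_prop) (by fun_prop) ?_
      positivity
    exact hc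

/-- `B` is continuous everywhere. -/
theorem continuous_peanoB : Continuous peanoB := by
  rw [continuous_iff_continuousAt]
  intro p
  by_cases hW : (4 * p 0 - 1) ^ 2 + (4 * p 1 - 1) ^ 2 = 0
  · obtain ⟨hp0, hp1⟩ := eq_quarter_of_den_eq_zero hW
    have hB0 : peanoB p = 0 := by
      simp only [peanoB, hW]
      simp
    have hg : Tendsto (fun q : Fin 2 → ℝ => |4 * q 0 - 1| / 2) (𝓝 p) (𝓝 0) := by
      have hc : Continuous (fun q : Fin 2 → ℝ => |4 * q 0 - 1| / 2) := by fun_prop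
      have := hc.tendsto p
      simpa [hp0] using this
    rw [ContinuousAt, hB0]
    exact squeeze_zero_norm (fun q => by simpa [Real.norm_eq_abs] using abs_peanoB_le q) hg
  · have hc : ContinuousAt (fun q : Fin 2 → ℝ =>
        (4 * q 0 - 1) * ((4 * q 0 - 1) ^ 4 - 4 * (4 * q 0 - 1) ^ 2 * (4 * q 1 - 1) ^ 2 - (4 * q 1 - 1) ^ 4) /
          (4 * ((4 * q 0 - 1) ^ 2 + (4 * q 1 - 1) ^ 2) ^ 2)) p := by
      refine ContinuousAt.div (by fun_prop) (by fun_prop) ?_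
      positivity
    exact hc

/-! ## Differentiability of the potential with gradient `(A, B)` -/

/-- Off the singular point, `dS = A da + B db` (calculus of `HasFDerivAt`, one clean step at a time). -/
theorem hasFDerivAt_peanoS_of_ne {p : Fin 2 → ℝ} (hW : (4 * p 0 - 1) ^ 2 + (4 * p 1 - 1) ^ 2 ≠ 0) :
    HasFDerivAt peanoS (peanoA p • ContinuousLinearMap.proj (R := ℝ) (φ := fun _ : Fin 2 => ℝ) 0 +
        peanoB p • ContinuousLinearMap.proj (R := ℝ) (φ := fun _ : Fin 2 => ℝ) 1) p := by
  have hU : HasFDerivAt (fun q : Fin 2 → ℝ => 4 * q 0 - 1)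
      ((4 : ℝ) • ContinuousLinearMap.proj (R := ℝ) (φ := fun _ : Fin 2 => ℝ) 0) p :=
    ((ContinuousLinearMap.proj (R := ℝ) (φ := fun _ : Fin 2 => ℝ) 0).hasFDerivAt.const_mul (4 : ℝ)).sub_const 1
  have hV : HasFDerivAt (fun q : Fin 2 → ℝ => 4 * q 1 - 1)
      ((4 : ℝ) • ContinuousLinearMap.proj (R := ℝ) (φ := fun _ : Fin 2 => ℝ) 1) p :=
    ((ContinuousLinearMap.proj (R := ℝ) (φ := fun _ : Fin 2 => ℝ) 1).hasFDerivAt.const_mul (4 : ℝ)).sub_const 1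
  -- the numerator `M = U V (U² − V²)`
  have hM : HasFDerivAt (fun q : Fin 2 → ℝ => (4 * q 0 - 1) * (4 * q 1 - 1) *
        ((4 * q 0 - 1) ^ 2 - (4 * q 1 - 1) ^ 2))
      ((4 * ((4 * p 1 - 1) * ((4 * p 0 - 1) ^ 2 - (4 * p 1 - 1) ^ 2) +
          (4 * p 0 - 1) * (4 * p 1 - 1) * (2 * (4 * p 0 - 1)))) •
          ContinuousLinearMap.proj (R := ℝ) (φ := fun _ : Fin 2 => ℝ) 0 +
        (4 * ((4 * p 0 - 1) * ((4 * p 0 - 1) ^ 2 - (4 * p 1 - 1) ^ 2) -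
          (4 * p 0 - 1) * (4 * p 1 - 1) * (2 * (4 * p 1 - 1)))) •
          ContinuousLinearMap.proj (R := ℝ) (φ := fun _ : Fin 2 => ℝ) 1) p := by
    have h := (hU.fun_mul hV).fun_mul ((hU.pow 2).fun_sub (hV.pow 2))
    exact h.congr_fderiv (ContinuousLinearMap.ext fun v => by simp; ring)
  -- the denominator `E = 16 (U² + V²)` and its inverse
  have hE : HasFDerivAt (fun q : Fin 2 → ℝ => 16 * ((4 * q 0 - 1) ^ 2 + (4 * q 1 - 1) ^ 2))
      ((16 * (2 * (4 * p 0 - 1) * 4)) • ContinuousLinearMap.proj (R := ℝ) (φ := fun _ : Fin 2 => ℝ) 0 +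
        (16 * (2 * (4 * p 1 - 1) * 4)) • ContinuousLinearMap.proj (R := ℝ) (φ := fun _ : Fin 2 => ℝ) 1) p := by
    have h := ((hU.pow 2).fun_add (hV.pow 2)).const_mul (16 : ℝ)
    exact h.congr_fderiv (ContinuousLinearMap.ext fun v => by simp; ring)
  have hE0 : 16 * ((4 * p 0 - 1) ^ 2 + (4 * p 1 - 1) ^ 2) ≠ 0 := mul_ne_zero (by norm_num) hW
  have hEinv : HasFDerivAt (fun q : Fin 2 → ℝ => (16 * ((4 * q 0 - 1) ^ 2 + (4 * q 1 - 1) ^ 2))⁻¹)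
      ((-((16 * ((4 * p 0 - 1) ^ 2 + (4 * p 1 - 1) ^ 2)) ^ 2)⁻¹ * (16 * (2 * (4 * p 0 - 1) * 4))) •
          ContinuousLinearMap.proj (R := ℝ) (φ := fun _ : Fin 2 => ℝ) 0 +
        (-((16 * ((4 * p 0 - 1) ^ 2 + (4 * p 1 - 1) ^ 2)) ^ 2)⁻¹ * (16 * (2 * (4 * p 1 - 1) * 4))) •
          ContinuousLinearMap.proj (R := ℝ) (φ := fun _ : Fin 2 => ℝ) 1) p := by
    have h := (hasFDerivAt_inv hE0).comp p hE
    exact h.congr_fderiv (ContinuousLinearMap.ext fun v => by simp; ring)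
  -- `S = M · E⁻¹`
  have hS := hM.fun_mul hEinv
  have hfun : peanoS = fun q : Fin 2 → ℝ => (4 * q 0 - 1) * (4 * q 1 - 1) *
      ((4 * q 0 - 1) ^ 2 - (4 * q 1 - 1) ^ 2) * (16 * ((4 * q 0 - 1) ^ 2 + (4 * q 1 - 1) ^ 2))⁻¹ := by
    funext q
    simp only [peanoS, div_eq_mul_inv]
  rw [hfun]
  refine hS.congr_fderiv (ContinuousLinearMap.ext fun v => ?_)
  simp [peanoA, peanoB]
  field_simp
  ring

/-- At the singular point the potential is flat: `|S(¼ + h)| ≤ ‖h‖²`, so `dS = 0 = A da + B db`. -/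
theorem hasFDerivAt_peanoS_quarter {p : Fin 2 → ℝ} (hp0 : p 0 = 1/4) (hp1 : p 1 = 1/4) :
    HasFDerivAt peanoS (peanoA p • ContinuousLinearMap.proj (R := ℝ) (φ := fun _ : Fin 2 => ℝ) 0 +
        peanoB p • ContinuousLinearMap.proj (R := ℝ) (φ := fun _ : Fin 2 => ℝ) 1) p := by
  have hA0 : peanoA p = 0 := by simp [peanoA, hp0, hp1]
  have hB0 : peanoB p = 0 := by simp [peanoB, hp0, hp1]
  have hS0 : peanoS p = 0 := by simp [peanoS, hp0, hp1]
  rw [hA0, hB0, zero_smul, zero_smul, add_zero]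
  rw [hasFDerivAt_iff_isLittleO_nhds_zero]
  change (fun h : Fin 2 → ℝ => peanoS (p + h) - peanoS p - 0) =o[𝓝 0] fun h => h
  simp only [sub_zero, hS0]
  refine Asymptotics.isLittleO_iff.mpr fun ε hε => ?_
  filter_upwards [Metric.ball_mem_nhds (0 : Fin 2 → ℝ) hε] with h hh
  rw [Metric.mem_ball, dist_zero_right] at hh
  -- `|S(p + h)| ≤ ‖h‖ ^ 2`
  have hU : 4 * (p + h) 0 - 1 = 4 * h 0 := by simp [hp0]; ring
  have hV : 4 * (p + h) 1 - 1 = 4 * h 1 := by simp [hp1]; ring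
  have hbound : ‖peanoS (p + h)‖ ≤ ‖h‖ * ‖h‖ := by
    rw [Real.norm_eq_abs]
    simp only [peanoS, hU, hV]
    have h0 : |h 0| ≤ ‖h‖ := by simpa using norm_le_pi_norm h 0
    have h1 : |h 1| ≤ ‖h‖ := by simpa using norm_le_pi_norm h 1
    by_cases hW : (4 * h 0) ^ 2 + (4 * h 1) ^ 2 = 0
    · rw [hW]
      simp only [mul_zero, div_zero, abs_zero]
      positivity
    · have hWpos : 0 < (4 * h 0) ^ 2 + (4 * h 1) ^ 2 := lt_of_le_of_ne (by positivity) (Ne.symm hW)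
      rw [abs_div, abs_of_pos (by positivity : (0:ℝ) < 16 * ((4 * h 0) ^ 2 + (4 * h 1) ^ 2)),
        div_le_iff₀ (by positivity)]
      rw [abs_mul, abs_mul]
      have hdiff : |(4 * h 0) ^ 2 - (4 * h 1) ^ 2| ≤ (4 * h 0) ^ 2 + (4 * h 1) ^ 2 := by
        rw [abs_le]; constructor <;> nlinarith [sq_nonneg (4 * h 0), sq_nonneg (4 * h 1)]
      have ha : |4 * h 0| ≤ 4 * ‖h‖ := by rw [abs_mul]; norm_num; linarith
      have hb : |4 * h 1| ≤ 4 * ‖h‖ := by rw [abs_mul]; norm_num; linarith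
      have hn : 0 ≤ ‖h‖ := norm_nonneg h
      calc |4 * h 0| * |4 * h 1| * |(4 * h 0) ^ 2 - (4 * h 1) ^ 2|
          ≤ (4 * ‖h‖) * (4 * ‖h‖) * ((4 * h 0) ^ 2 + (4 * h 1) ^ 2) := by
            exact mul_le_mul (mul_le_mul ha hb (abs_nonneg _) (by positivity)) hdiff (abs_nonneg _)
              (by positivity)
        _ = ‖h‖ * ‖h‖ * (16 * ((4 * h 0) ^ 2 + (4 * h 1) ^ 2)) := by ring
  calc ‖peanoS (p + h)‖ ≤ ‖h‖ * ‖h‖ := hbound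
    _ ≤ ε * ‖h‖ := by gcongr

/-- `dS = A da + B db` everywhere. -/
theorem hasFDerivAt_peanoS (p : Fin 2 → ℝ) :
    HasFDerivAt peanoS (peanoA p • ContinuousLinearMap.proj (R := ℝ) (φ := fun _ : Fin 2 => ℝ) 0 +
        peanoB p • ContinuousLinearMap.proj (R := ℝ) (φ := fun _ : Fin 2 => ℝ) 1) p := by
  by_cases hW : (4 * p 0 - 1) ^ 2 + (4 * p 1 - 1) ^ 2 = 0
  · obtain ⟨hp0, hp1⟩ := eq_quarter_of_den_eq_zero hW
    exact hasFDerivAt_peanoS_quarter hp0 hp1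
  · exact hasFDerivAt_peanoS_of_ne hW

/-! ## The refutation -/

/-- **The pointwise strengthening of `stub_mixedPartials` is false** (shifted Peano potential): at
`(¼,¼) ∈ Δ°` both fibre derivatives exist, `∂_b A = −1`, `∂_a B = 1`. So the exceptional set of
`stub_mixedPartials` must contain the `C¹`-singular points of `(A, B)`, not only the loci where a
fibre derivative fails to exist. -/
theorem not_mixedPartialsPointwise : ¬ MixedPartialsPointwise := by
  intro h
  -- the closed triangle is semialgebraic (inline; cf. `CurvePeriodsTransferNegative.isSemialgebraic_stdTriangle`)
  have hT : IsSemialgebraic ℚ {p : Fin 2 → ℝ | 0 ≤ p 0 ∧ 0 ≤ p 1 ∧ p 0 + p 1 ≤ 1} := by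
    have h0 : IsSemialgebraic ℚ {x : Fin 2 → ℝ | 0 ≤ x 0} := by
      simpa using isSemialgebraic_setOf_eval_le (k := ℚ) (R := ℝ) (ι := Fin 2) (C 0) (X 0)
    have h1 : IsSemialgebraic ℚ {x : Fin 2 → ℝ | 0 ≤ x 1} := by
      simpa using isSemialgebraic_setOf_eval_le (k := ℚ) (R := ℝ) (ι := Fin 2) (C 0) (X 1)
    have h2 : IsSemialgebraic ℚ {x : Fin 2 → ℝ | x 0 + x 1 ≤ 1} := by
      have e : {x : Fin 2 → ℝ | x 0 + x 1 ≤ 1} = {x : Fin 2 → ℝ |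
          aeval x (X 0 + X 1 : MvPolynomial (Fin 2) ℚ) ≤ aeval x (C 1 : MvPolynomial (Fin 2) ℚ)} := by
        ext x
        simp only [mem_setOf_eq, map_add, MvPolynomial.aeval_X, map_one]
      rw [e]
      exact isSemialgebraic_setOf_eval_le _ _
    have hEq : {p : Fin 2 → ℝ | 0 ≤ p 0 ∧ 0 ≤ p 1 ∧ p 0 + p 1 ≤ 1} =
        {x : Fin 2 → ℝ | 0 ≤ x 0} ∩ ({x : Fin 2 → ℝ | 0 ≤ x 1} ∩ {x : Fin 2 → ℝ | x 0 + x 1 ≤ 1}) := by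
      ext p; simp
    rw [hEq]
    exact h0.inter (h1.inter h2)
  have key := h peanoA peanoB peanoS (isSemialgebraicFunOn_peanoA hT) (isSemialgebraicFunOn_peanoB hT)
    continuous_peanoA.continuousOn continuous_peanoB.continuousOn
    (fun p _ _ _ => hasFDerivAt_peanoS p) ![1/4, 1/4] (by norm_num) (by norm_num) (by norm_num)
    hasDerivAt_peanoA_fibre.differentiableAt hasDerivAt_peanoB_fibre.differentiableAt
  rw [hasDerivAt_peanoA_fibre.deriv, hasDerivAt_peanoB_fibre.deriv] at key
  norm_num at key

end Summit.KontsevichZagierPeriods.PlanarAreas.Negative.GreenBands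

end
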